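import Mathlib.NumberTheory.NumberField.Units.DirichletTheorem
import Literature.NumberTheory.Transcendental.PadicLogOpenBall
import Literature.NumberTheory.Transcendental.PadicLogAlgClProofs
import Literature.NumberTheory.Automorphic.HilbertPartialHasseWeightShiftingProofs
import Literature.AnabelianGeometry.AbsoluteAnabelian.AbsTopIII.MLFGaloisModelRigidity
import HarnessLib

/-!
# The kernel of the Iwasawa logarithm on algebraic units: `log_p τ(u) = 0 ⟹ u` is torsion

Support file 3 of the brick «(b) weak Leopoldt over `𝔎_∞`: `Ē_∞ ↪ U_v`» (cell bsd-print-cf2, LEAD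
ruling B23 §4 (b)) for crux `PrintCf2RubinValueTwo.TwoVariableMainConjAtSplitTwo`
(stmt-BirchSwinnertonDyer-23720). Namespace `…Theorems.PrintCf2.LeopoldtAtV`.

For the `𝔭`-adic Leopoldt theorem (Baker–Brumer, de Shalit 1987 III.2.3) one needs that the
`p`-adic logarithms of multiplicatively independent units are `ℚ`-linearly independent, i.e. that
the Iwasawa logarithm `log_p : ℚ̄_pˣ → ℚ̄_p` (`padicLogAlgCl p`, tree file
`Transcendental/PadicLogAlgCl`) kills, among the units `‖x‖ = 1` of `ℚ̄_p`, exactly the roots of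
unity (Washington, Prop. 5.6).  Proved here:

* `exists_pow_eq_one_of_padicLogAlgCl_eq_zero` — `‖x‖ = 1`, `log_p x = 0 ⟹ xᵏ = 1` for some `k ≥ 1`
  (reduce to a principal unit `y = xᵏ`; in the complete field `ℚ_p(y)` the limit formula
  `(y^{pⁿ} − 1)/pⁿ → log y = 0` puts `y^{pᴺ}` in the ball `‖1 − z‖ < p⁻¹` on which the logarithmic
  series is an isometry (`PadicExp.norm_plog_of_norm_lt`), so `y^{pᴺ} = 1`);
  (the converse is the tree's `AbsTopIII.PadicAlgCl.log_eq_zero_of_pow_eq_one`);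
* for a number field `F`, an embedding `τ : F →+* ℚ̄_p` and a unit `u ∈ 𝓞_Fˣ`:
  `norm_embedding_unit` (`‖τ u‖ = 1`) and
  `padicLogAlgCl_embedding_unit_eq_zero_iff` — `log_p τ(u) = 0 ↔ u ∈ torsion F`.

References: L. C. Washington, *Introduction to Cyclotomic Fields*, GTM 83, Prop. 5.6;
S. Lang, *Cyclotomic Fields I and II*, Ch. 4, Appendix to §3; E. de Shalit 1987, III.2.3.
-/

noncomputable section

set_option linter.dupNamespace false -- `Summit.BirchSwinnertonDyer.BirchSwinnertonDyer` (summit = problem) is the tree's layout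
set_option autoImplicit false

open NumberField Filter Topology

namespace Summit.BirchSwinnertonDyer.BirchSwinnertonDyer.Theorems.PrintCf2.LeopoldtAtV

open Literature.NumberTheory.Transcendental

variable {p : ℕ} [Fact p.Prime]

/-! ### §1. Principal units of a complete subextension with vanishing logarithm are roots of unity -/

/-- In a finite subextension `K ⊆ ℚ̄_p` of `ℚ_p`, a principal unit `Y` (`‖1 − Y‖ < 1`) whose
logarithmic series vanishes is a root of unity of `p`-power order: `Y ^ (p ^ N) = 1` for some `N`.
[cite: Washington1997, Prop. 5.6] -/
theorem exists_pow_prime_pow_eq_one_of_tsum_eq_zero (K : IntermediateField ℚ_[p] (PadicAlgCl p))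
    [FiniteDimensional ℚ_[p] K] (Y : K) (hY : ‖1 - Y‖ < 1)
    (h0 : (∑' n : ℕ, -((1 - Y) ^ (n + 1)) / (n + 1 : K)) = 0) :
    ∃ N : ℕ, Y ^ (p ^ N) = 1 := by
  have hp : p.Prime := Fact.out
  haveI : CompleteSpace K := FiniteDimensional.complete ℚ_[p] K
  haveI : IsUltrametricDist K := IsUltrametricDist.of_normedAlgebra ℚ_[p]
  -- `K` is nontrivially normed: `‖(p : K)‖ = p⁻¹ < 1`
  have hpK : ‖(p : K)‖ = (p : ℝ)⁻¹ := by
    rw [IwasawaLog.norm_natCast p (F := K) p, Padic.norm_p]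
  have hp1 : 1 < (p : ℝ) := by exact_mod_cast hp.one_lt
  letI : NontriviallyNormedField K :=
    { (inferInstance : NormedField K) with
      non_trivial := ⟨(p : K)⁻¹, by
        rw [norm_inv, hpK, inv_inv]; exact hp1⟩ }
  -- the limit formula `(Y^{pⁿ} − 1)/pⁿ → L(Y) = 0`
  have hlim := IwasawaLog.tendsto_pow_prime_pow_sub_one_div (p := p) Y hY
  rw [h0] at hlim
  have hsmall : ∀ᶠ n : ℕ in atTop, ‖(Y ^ (p ^ n) - 1) / (p : K) ^ n‖ < (p : ℝ)⁻¹ := by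
    have := (tendsto_order.1 (tendsto_norm_zero.comp hlim)).2 (p : ℝ)⁻¹ (by positivity)
    simpa using this
  obtain ⟨N, hN⟩ := hsmall.exists
  have hpK0 : (p : K) ≠ 0 := by
    intro h; rw [h, norm_zero] at hpK; exact (inv_pos.mpr (by positivity : (0:ℝ) < p)).ne hpK
  have hz : ‖1 - Y ^ (p ^ N)‖ < (p : ℝ)⁻¹ := by
    have h1 : Y ^ (p ^ N) - 1 = (Y ^ (p ^ N) - 1) / (p : K) ^ N * (p : K) ^ N := by
      rw [div_mul_cancel₀ _ (pow_ne_zero _ hpK0)]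
    have h2 : ‖(p : K) ^ N‖ ≤ 1 := by
      rw [norm_pow, hpK]; exact pow_le_one₀ (by positivity) (inv_le_one_of_one_le₀ hp1.le)
    rw [norm_sub_rev, h1, norm_mul]
    calc ‖(Y ^ (p ^ N) - 1) / (p : K) ^ N‖ * ‖(p : K) ^ N‖
        ≤ ‖(Y ^ (p ^ N) - 1) / (p : K) ^ N‖ * 1 := by gcongr
      _ < (p : ℝ)⁻¹ := by rw [mul_one]; exact hN
  -- on the ball `‖1 − z‖ < p⁻¹` the logarithmic series is an isometry
  have hplog : PadicExp.plog (Y ^ (p ^ N)) = 0 := by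
    rw [PadicExp.plog_pow (ℓ := p) hY, show PadicExp.plog Y = 0 from h0, mul_zero]
  have hnorm := PadicExp.norm_plog_of_norm_lt (ℓ := p) hz
  rw [hplog, norm_zero] at hnorm
  refine ⟨N, ?_⟩
  have : 1 - Y ^ (p ^ N) = 0 := norm_eq_zero.mp hnorm.symm
  exact (sub_eq_zero.mp this).symm

/-- **The Iwasawa logarithm kills only roots of unity among the units of `ℚ̄_p`**: if `‖x‖ = 1`
and `log_p x = 0` then `x ^ k = 1` for some `k ≥ 1`. [cite: Washington1997, Prop. 5.6] -/
theorem exists_pow_eq_one_of_padicLogAlgCl_eq_zero {x : PadicAlgCl p} (hx : ‖x‖ = 1)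
    (h0 : padicLogAlgCl p x = 0) : ∃ k : ℕ, 0 < k ∧ x ^ k = 1 := by
  have hp : p.Prime := Fact.out
  have hlog := padicLogAlgCl_isIwasawaLog_holds p
  -- a principal unit power `y = x ^ k`
  obtain ⟨k, hk, hk1⟩ := IwasawaLog.exists_norm_one_sub_pow_lt hx
  have hx0 : x ≠ 0 := by intro h; rw [h, norm_zero] at hx; exact zero_ne_one hx
  have hy0 : padicLogAlgCl p (x ^ k) = 0 := by rw [hlog.log_pow hx0, h0, mul_zero]
  -- pass to the complete field `ℚ_p(y)`
  set y : PadicAlgCl p := x ^ k with hy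
  haveI : FiniteDimensional ℚ_[p] (IntermediateField.adjoin ℚ_[p] {y}) :=
    IntermediateField.adjoin.finiteDimensional (Algebra.IsAlgebraic.isAlgebraic y).isIntegral
  set Y : IntermediateField.adjoin ℚ_[p] {y} := ⟨y, IntermediateField.mem_adjoin_simple_self ℚ_[p] y⟩
    with hYdef
  have hYy : (Y : PadicAlgCl p) = y := rfl
  have hY : ‖1 - Y‖ < 1 := by
    change ‖((1 - Y : IntermediateField.adjoin ℚ_[p] {y}) : PadicAlgCl p)‖ < 1
    simpa [hYy] using hk1
  -- its logarithmic series, computed in `ℚ_p(y)`, is `log_p y = 0`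
  have hsum := IwasawaLog.hasSum_logSeries_coe (IntermediateField.adjoin ℚ_[p] {y}) Y
    (by simpa [hYy] using hk1)
  have hser : padicLogSeriesAlgCl p y =
      ((∑' n : ℕ, -((1 - Y) ^ (n + 1)) / (n + 1 : IntermediateField.adjoin ℚ_[p] {y}) :
        IntermediateField.adjoin ℚ_[p] {y}) : PadicAlgCl p) := by
    rw [hYy] at hsum
    exact (IwasawaLog.hasSum_padicLogSeriesAlgCl hk1).unique hsum
  have h0K : (∑' n : ℕ, -((1 - Y) ^ (n + 1)) / (n + 1 : IntermediateField.adjoin ℚ_[p] {y})) = 0 := by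
    have : ((∑' n : ℕ, -((1 - Y) ^ (n + 1)) / (n + 1 : IntermediateField.adjoin ℚ_[p] {y}) :
        IntermediateField.adjoin ℚ_[p] {y}) : PadicAlgCl p) = 0 := by
      rw [← hser, ← IwasawaLog.log_eq_padicLogSeriesAlgCl hk1, hy0]
    exact_mod_cast this
  obtain ⟨N, hN⟩ := exists_pow_prime_pow_eq_one_of_tsum_eq_zero _ Y hY h0K
  refine ⟨k * p ^ N, Nat.mul_pos hk (pow_pos hp.pos N), ?_⟩
  have : ((Y ^ (p ^ N) : IntermediateField.adjoin ℚ_[p] {y}) : PadicAlgCl p) = 1 := by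
    rw [hN]; rfl
  rw [pow_mul, ← hy, ← hYy]
  exact_mod_cast this

/-! ### §2. Units of a number field under an embedding into `ℚ̄_p` -/

section NumberField

variable {F : Type*} [Field F]

/-- A unit of the ring of integers of a number field has norm `1` under every embedding
`τ : F →+* ℚ̄_p` (it and its inverse are integral over `ℤ`). [folklore] -/
theorem norm_embedding_unit (τ : F →+* PadicAlgCl p) (u : (𝓞 F)ˣ) :
    ‖τ (algebraMap (𝓞 F) F (u : 𝓞 F))‖ = 1 := by
  have hint : ∀ v : (𝓞 F)ˣ, ‖τ (algebraMap (𝓞 F) F (v : 𝓞 F))‖ ≤ 1 := fun v ↦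
    Literature.NumberTheory.Automorphic.PadicAlgCl.norm_le_one_of_isIntegral p
      ((RingOfIntegers.isIntegral_coe (v : 𝓞 F)).map τ.toIntAlgHom)
  refine le_antisymm (hint u) ?_
  have hmul : τ (algebraMap (𝓞 F) F (u : 𝓞 F)) * τ (algebraMap (𝓞 F) F ((u⁻¹ : (𝓞 F)ˣ) : 𝓞 F))
      = 1 := by
    rw [← map_mul, ← map_mul, Units.mul_inv, map_one, map_one]
  have h1 : ‖τ (algebraMap (𝓞 F) F (u : 𝓞 F))‖ *
      ‖τ (algebraMap (𝓞 F) F ((u⁻¹ : (𝓞 F)ˣ) : 𝓞 F))‖ = 1 := by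
    rw [← norm_mul, hmul, norm_one]
  by_contra hlt
  rw [not_le] at hlt
  have : ‖τ (algebraMap (𝓞 F) F (u : 𝓞 F))‖ *
      ‖τ (algebraMap (𝓞 F) F ((u⁻¹ : (𝓞 F)ˣ) : 𝓞 F))‖ < 1 * 1 :=
    mul_lt_mul_of_lt_of_le_of_nonneg_of_pos hlt (hint u⁻¹) (norm_nonneg _) one_pos
  rw [h1, one_mul] at this
  exact lt_irrefl _ this

/-- **`log_p τ(u) = 0` only for roots of unity**: for a unit `u ∈ 𝓞_Fˣ` of a number field and an
embedding `τ : F →+* ℚ̄_p`, if `log_p τ(u) = 0` then `u ∈ torsion F`. [cite: Washington1997, Prop. 5.6] -/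
theorem mem_torsion_of_padicLogAlgCl_eq_zero (τ : F →+* PadicAlgCl p) (u : (𝓞 F)ˣ)
    (h : padicLogAlgCl p (τ (algebraMap (𝓞 F) F (u : 𝓞 F))) = 0) : u ∈ Units.torsion F := by
  obtain ⟨k, hk, hk1⟩ := exists_pow_eq_one_of_padicLogAlgCl_eq_zero (norm_embedding_unit τ u) h
  rw [Units.torsion, CommGroup.mem_torsion, isOfFinOrder_iff_pow_eq_one]
  refine ⟨k, hk, ?_⟩
  ext
  apply τ.injective
  simp only [Units.val_pow_eq_pow_val, Units.val_one, map_pow, map_one]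
  exact hk1

/-- For a unit `u ∈ 𝓞_Fˣ` and an embedding `τ : F →+* ℚ̄_p`: `log_p τ(u) = 0 ↔ u ∈ torsion F`.
[cite: Washington1997, Prop. 5.6] -/
theorem padicLogAlgCl_embedding_unit_eq_zero_iff (τ : F →+* PadicAlgCl p) (u : (𝓞 F)ˣ) :
    padicLogAlgCl p (τ (algebraMap (𝓞 F) F (u : 𝓞 F))) = 0 ↔ u ∈ Units.torsion F := by
  refine ⟨mem_torsion_of_padicLogAlgCl_eq_zero τ u, fun hu ↦ ?_⟩
  rw [Units.torsion, CommGroup.mem_torsion, isOfFinOrder_iff_pow_eq_one] at hu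
  obtain ⟨k, hk, hk1⟩ := hu
  refine Literature.AnabelianGeometry.AbsoluteAnabelian.AbsTopIII.PadicAlgCl.log_eq_zero_of_pow_eq_one hk ?_
  have h1 := congrArg (fun v : (𝓞 F)ˣ ↦ τ (algebraMap (𝓞 F) F (v : 𝓞 F))) hk1
  simpa only [Units.val_pow_eq_pow_val, map_pow, Units.val_one, map_one] using h1

end NumberField

end Summit.BirchSwinnertonDyer.BirchSwinnertonDyer.Theorems.PrintCf2.LeopoldtAtV

end
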